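import Summits.NavierStokesRegularity.NavierStokesRegularity.Theses.ExtremiserTransience
import Literature.Analysis.FluidPDE.VorticityCalculus
import HarnessLib.Audit

/-!
# LINE «campbell_extremiser» — support sketch: the FIRST LEMMA of the variational crux S2 (`stub_windowContact`), typed (ns-idea-10 g4)

EULER–LAGRANGE FOR LAWS needs ONE structural fact before any calculus: the class of |ω(0)|²-twisted stationary laws (Campbell–Mecke identity) is
EXACTLY INVARIANT under translation-EQUIVARIANT deformations of the field, re-twisted by the new vorticity at the origin.  Concretely, on the SAME
probability space: if `(P, V)` is a Campbell law and `F` commutes with translations, then `V_ε w := V w + ε • F (V w)` under the re-weighted measure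
`P_ε := c⁻¹ • P.withDensity (|curl V_ε w (0)|² / |curl V w (0)|²)` is again a Campbell law — for EVERY ε, not only to first order.  (Proof on paper, five
lines: apply the Campbell–Mecke identity of `(P, V)` to `Ψ(V) := Φ(V_ε) · |ω_ε(−a)|²/|ω(−a)|²`, which is a functional of `V` alone BECAUSE `F` is
equivariant, so `Ψ(V(·+a)) = Φ(V_ε(·+a)) · |ω_ε(0)|²/|ω(0)|²`; the weights telescope on `{ω(−a) ≠ 0}`, a `P`-full set by Campbell at `Φ = 1_{ω(0)=0}`;
bounded `Φ` ⇒ non-negative measurable `Ψ` by monotone class.)  Consequence used by S2: the efficiency `R(P_ε, V_ε)` of the deformed law is a genuine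
competitor in the SAME class, so at a maximiser `d/dε R(P_ε, V_ε)|_{ε=0} = 0` for every admissible equivariant `F` (Leray-projected local factor maps
`F(V)(x) = 𝖯 f(V(x), ∇V(x), …)`), which is the pointwise Euler–Lagrange system off the contact set.  This file types the invariance as a stub over a
minimal interface `IsCampbellLaw` (the Campbell–Mecke clause of `IsCampbellExtremal` + `ω(0) ≠ 0` a.s.); size M.  REV 2 (critic V40 prices P3/P4):
it also books the two FIRST LEMMAS the critic asked to see typed separately — `stub_noGainFromLaws` (SHARED: S2 step (a) = LINE 1's B2 universe =
26686's extended-class issue, booked once) and `stub_palmTightness` (the one estimate inside S1, static form, with its concrete failure mode).  REV 3 (critic V41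
P2): + the internal lemmas of S1a — `stub_windowFatou` (reverse Fatou for the extremal τ-sets; true) and `stub_retwistAbsCont` (re-twisting a
space–time Campbell law to time τ, P_τ ∼ P; true modulo side conditions) over a minimal `IsSpaceTimeCampbellLaw`; the skeleton (rev 3) carries
the split S1 = S1a `stub_preLawExtraction` + S1b `stub_ergodicSelection` + S1c `stub_supNormalise` with a kernel-checked recomposition.  None of
the stubs here is in the skeleton's composition (first-lemma records: visible, attackable, refutable).  No summit is proved by this line.
-/

noncomputable section

open Set MeasureTheory Filter Topology
open scoped InnerProductSpace RealInnerProductSpace ENNReal NNReal ContDiff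
open Literature.Analysis.FluidPDE

set_option linter.dupNamespace false

namespace Summit.NavierStokesRegularity.NavierStokesRegularity.Cruxes.NearExtremalTransience.CampbellExtremiser

/-- Minimal CAMPBELL-LAW interface: a random field `V` on `(Ω, P)` (P a probability), jointly measurable, with non-zero vorticity at the origin a.s.,
integrable shift weights, and the Campbell–Mecke twisted-stationarity identity for bounded measurable functionals — verbatim the corresponding clauses
of `IsCampbellExtremal`. -/
def IsCampbellLaw {Ω : Type*} [MeasurableSpace Ω] (P : Measure Ω)
    (V : Ω → EuclideanSpace ℝ (Fin 3) → EuclideanSpace ℝ (Fin 3)) : Prop :=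
  IsProbabilityMeasure P ∧ Measurable (Function.uncurry V) ∧
  (∀ᵐ w ∂P, ContDiff ℝ (⊤ : ℕ∞) (V w) ∧ curl (V w) 0 ≠ 0) ∧
  (∀ a : EuclideanSpace ℝ (Fin 3), Integrable (fun w => ‖curl (V w) (-a)‖ ^ 2 / ‖curl (V w) 0‖ ^ 2) P) ∧
  (∀ (a : EuclideanSpace ℝ (Fin 3)) (Φ : (EuclideanSpace ℝ (Fin 3) → EuclideanSpace ℝ (Fin 3)) → ℝ),
      Measurable Φ → (∀ v, |Φ v| ≤ 1) →
      ∫ w, Φ (fun y => V w (y + a)) ∂P = ∫ w, Φ (V w) * (‖curl (V w) (-a)‖ ^ 2 / ‖curl (V w) 0‖ ^ 2) ∂P)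

/-- A deformation map `F : field ↦ field` is TRANSLATION-EQUIVARIANT. -/
def IsShiftEquivariant
    (F : (EuclideanSpace ℝ (Fin 3) → EuclideanSpace ℝ (Fin 3)) → (EuclideanSpace ℝ (Fin 3) → EuclideanSpace ℝ (Fin 3))) : Prop :=
  ∀ (v : EuclideanSpace ℝ (Fin 3) → EuclideanSpace ℝ (Fin 3)) (a x : EuclideanSpace ℝ (Fin 3)),
    F (fun y => v (y + a)) x = F v (x + a)

/-- The deformed field `V_ε w := V w + ε • F (V w)` (same probability space). -/
def deformField {Ω : Type*}
    (V : Ω → EuclideanSpace ℝ (Fin 3) → EuclideanSpace ℝ (Fin 3))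
    (F : (EuclideanSpace ℝ (Fin 3) → EuclideanSpace ℝ (Fin 3)) → (EuclideanSpace ℝ (Fin 3) → EuclideanSpace ℝ (Fin 3))) (ε : ℝ) :
    Ω → EuclideanSpace ℝ (Fin 3) → EuclideanSpace ℝ (Fin 3) :=
  fun w x => V w x + ε • F (V w) x

/-- The re-twisting density `|curl V_ε w (0)|² / |curl V w (0)|²` (as `ℝ≥0∞`). -/
def retwistDensity {Ω : Type*}
    (V : Ω → EuclideanSpace ℝ (Fin 3) → EuclideanSpace ℝ (Fin 3))
    (F : (EuclideanSpace ℝ (Fin 3) → EuclideanSpace ℝ (Fin 3)) → (EuclideanSpace ℝ (Fin 3) → EuclideanSpace ℝ (Fin 3))) (ε : ℝ) :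
    Ω → ℝ≥0∞ :=
  fun w => ENNReal.ofReal (‖curl (deformField V F ε w) 0‖ ^ 2 / ‖curl (V w) 0‖ ^ 2)

/-- **First lemma of S2 (support stub, size M): EXACT INVARIANCE OF THE CAMPBELL CLASS UNDER EQUIVARIANT DEFORMATIONS.**  If `(P, V)` is a
Campbell law, `F` is shift-equivariant and measurable as a map of jointly-measurable fields, the deformed realisations are smooth with non-zero
vorticity at the origin a.s., and the re-twisting density has total mass `c ∈ (0, ∞)` with integrable shifted weights, then the re-weighted,
normalised measure `c⁻¹ • P.withDensity ρ_ε` and the deformed field `V_ε` form a Campbell law again.  Paper proof: module docstring (Campbell–Mecke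
applied to `Ψ(V) = Φ(V_ε)·|ω_ε(−a)|²/|ω(−a)|²`, equivariance, telescoping on the `P`-full set `{ω(−a) ≠ 0}`, monotone class).  Why it might fail:
only through a mis-typed side condition (the mathematics is exact); the integrability clause of the conclusion is assumed, not derived.
[sources: Mecke 1967 / LastPenrose2017 Ch. 9 (Palm calculus, Mecke equation); Kallenberg2021] -/
theorem stub_campbellLaw_deform
    {Ω : Type} [MeasurableSpace Ω] (P : Measure Ω)
    (V : Ω → EuclideanSpace ℝ (Fin 3) → EuclideanSpace ℝ (Fin 3))
    (F : (EuclideanSpace ℝ (Fin 3) → EuclideanSpace ℝ (Fin 3)) → (EuclideanSpace ℝ (Fin 3) → EuclideanSpace ℝ (Fin 3))) (ε : ℝ)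
    (hP : IsCampbellLaw P V) (hF : IsShiftEquivariant F)
    (hmeas : Measurable (Function.uncurry (deformField V F ε)))
    (hsmooth : ∀ᵐ w ∂P, ContDiff ℝ (⊤ : ℕ∞) (deformField V F ε w) ∧ curl (deformField V F ε w) 0 ≠ 0)
    (hρ : Measurable (retwistDensity V F ε))
    (hc0 : 0 < ∫⁻ w, retwistDensity V F ε w ∂P) (hc1 : ∫⁻ w, retwistDensity V F ε w ∂P < ⊤)
    (hint : ∀ a : EuclideanSpace ℝ (Fin 3),
      Integrable (fun w => ‖curl (deformField V F ε w) (-a)‖ ^ 2 / ‖curl (deformField V F ε w) 0‖ ^ 2)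
        ((∫⁻ w, retwistDensity V F ε w ∂P)⁻¹ • P.withDensity (retwistDensity V F ε))) :
    IsCampbellLaw ((∫⁻ w, retwistDensity V F ε w ∂P)⁻¹ • P.withDensity (retwistDensity V F ε)) (deformField V F ε) := by
  sorry


/-- **SHARED FIRST LEMMA «NO GAIN FROM LAWS» (critic V40 P4: booked ONCE here; it is step (a) of S2 `stub_windowContact`, it is the universe of
LINE 1 `gevrey_slack`'s B2, and it is the measure form of the extended-class issue that sank the first form of 26686; instrument I-GS1
(`Lines/gevrey_slack_igs1.md`) serves it: periodic patterns ARE Campbell laws).**  Every Campbell law of smooth divergence-free fields with speed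
bound `M` and uniformly bounded derivatives has efficiency at most `κ⋆`: `|E[ξ·Sξ]| ≤ κ⋆ · M · √(E[|∇ω|²/|ω|²])` (densities at the origin,
|ω(0)|²-normalised).  For the Palm law of ONE admissible `L²` field this is the definition of `κ⋆` (`E f = J/Z`, `E g = P/Z`); the content is the
extension to every twisted-stationary law (ergodic decomposition + Jensen reduce to ergodic laws; smooth-window truncation of a generic sample with
boundary cost `O(L²)` against bulk `L³`, using the tree's `DecayingSharpConstant` bookkeeping for the truncated field's admissibility).  Why it might
fail: an «extended-class gain» — a stationary law strictly more efficient than every `L²` field (then S2 has no maximiser to vary and LINE 1's B2 is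
false too).  Size L.  [sources: tree `DepletionLadder.sharpDepletion_is_universal`, Theses item 26686 history; Kallenberg2021 (ergodic decomposition);
Cruxes/NearExtremalTransience/Lines/gevrey_slack_igs1.md] -/
theorem stub_noGainFromLaws :
    ∀ (Ω : Type) (_ : MeasurableSpace Ω) (P : Measure Ω)
      (V : Ω → EuclideanSpace ℝ (Fin 3) → EuclideanSpace ℝ (Fin 3)) (M : ℝ),
      IsCampbellLaw P V → 0 < M →
      (∀ᵐ w ∂P, VectorCalculus.IsDivFree (V w) ∧ ∀ x, ‖V w x‖ ≤ M) →
      (∃ Bk : ℕ → ℝ, ∀ᵐ w ∂P, ∀ (k : ℕ) (x : EuclideanSpace ℝ (Fin 3)), ‖iteratedFDeriv ℝ k (V w) x‖ ≤ Bk k) →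
      Integrable (fun w => ⟪curl (V w) 0, fderiv ℝ (V w) 0 (curl (V w) 0)⟫_ℝ / ‖curl (V w) 0‖ ^ 2) P →
      Integrable (fun w => frobeniusNormSq (fderiv ℝ (curl (V w)) 0) / ‖curl (V w) 0‖ ^ 2) P →
        |∫ w, ⟪curl (V w) 0, fderiv ℝ (V w) 0 (curl (V w) 0)⟫_ℝ / ‖curl (V w) 0‖ ^ 2 ∂P| ≤
          sInf {κ : ℝ | ∀ (v : EuclideanSpace ℝ (Fin 3) → EuclideanSpace ℝ (Fin 3)) (M B : ℝ), ContDiff ℝ (⊤ : ℕ∞) v →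
      Literature.Analysis.FluidPDE.VectorCalculus.IsDivFree v → (∀ x, ‖v x‖ ≤ M) → (∀ x, ‖fderiv ℝ v x‖ ≤ B) →
      (∫⁻ x, ‖iteratedFDeriv ℝ 0 v x‖ₑ ^ 2 < ⊤) → (∫⁻ x, ‖iteratedFDeriv ℝ 1 v x‖ₑ ^ 2 < ⊤) →
      (∫⁻ x, ‖iteratedFDeriv ℝ 2 v x‖ₑ ^ 2 < ⊤) →
      |∫ x, ⟪Literature.Analysis.FluidPDE.curl v x, fderiv ℝ v x (Literature.Analysis.FluidPDE.curl v x)⟫_ℝ| ≤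
        κ * M * Real.sqrt (∫ x, ‖Literature.Analysis.FluidPDE.curl v x‖ ^ 2) *
          Real.sqrt (∫ x, Literature.Analysis.FluidPDE.frobeniusNormSq (fderiv ℝ (Literature.Analysis.FluidPDE.curl v) x))}
          * M * Real.sqrt (∫ w, frobeniusNormSq (fderiv ℝ (curl (V w)) 0) / ‖curl (V w) 0‖ ^ 2 ∂P) := by
  sorry

/-- **FIRST LEMMA OF S1 «PALM TIGHTNESS», STATIC FORM (critic V40 P3: the ONE estimate inside `stub_campbellWindowExtraction`, typed so it is
visible and separately attackable / refutable).**  NO VORTICITY-MASS LEAKAGE NEAR EXTREMALITY: for every `δ > 0` there are `η, ε > 0` such that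
every admissible non-degenerate field within `ε` of `κ⋆` in efficiency carries at most a `δ`-fraction of its enstrophy where the vorticity amplitude
is below `η · M/λ`, `λ = √(Z/P)` (written division-free: `|ω(x)|²·Z ≤ η²·M²·P`).  This is exactly tightness, away from `0`, of `|ω(0)|/(M/λ)` under
the Palm sampling `x ~ |ω|²dx/Z` — the condition under which the Campbell–Mecke identity and the clause `ω(0) ≠ 0 a.s.` pass to the blow-up limit
law.  Why it might fail (concretely): a MULTI-SCALE near-extremal superposition — a near-extremal core plus a low-amplitude, large-scale, itself
near-efficient «haze» carrying a fixed enstrophy fraction (Cauchy–Schwarz only gives `R ≤ max(R_core, R_haze)`, so the haze need not cost efficiency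
if it reaches near-top SPEED at tiny VORTICITY); if such a family exists this static form is false and S1 must use the FLOW form (tightness only
along scale-locked near-efficient slices of one Leray–Hopf flow, where the lock `Z/P = ν(T−t)` and Leray's rate constrain the haze) or the
CONDITIONING evasion (degenerate limit realisations are constant fields, a shift-invariant event; condition it away — efficiency does not drop:
`R(P) = √(1−δ') · R(P | non-degenerate)`).  Size M/L.  [sources: LastPenrose2017 Ch. 9; tree `PerFlow.scaleLock_at_nearEfficient_times`;
Theorems/ExtremiserTransienceKStarAttainedContact.lean (admissibility literal)] -/
theorem stub_palmTightness :
    ∀ δ : ℝ, 0 < δ → ∃ η : ℝ, 0 < η ∧ ∃ ε : ℝ, 0 < ε ∧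
      ∀ (v : EuclideanSpace ℝ (Fin 3) → EuclideanSpace ℝ (Fin 3)) (M B : ℝ),
        ContDiff ℝ (⊤ : ℕ∞) v → VectorCalculus.IsDivFree v → (∀ x, ‖v x‖ ≤ M) → (∀ x, ‖fderiv ℝ v x‖ ≤ B) →
        (∫⁻ x, ‖iteratedFDeriv ℝ 0 v x‖ₑ ^ 2 < ⊤) → (∫⁻ x, ‖iteratedFDeriv ℝ 1 v x‖ₑ ^ 2 < ⊤) →
        (∫⁻ x, ‖iteratedFDeriv ℝ 2 v x‖ₑ ^ 2 < ⊤) →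
        0 < M * Real.sqrt (∫ x, ‖curl v x‖ ^ 2) * Real.sqrt (∫ x, frobeniusNormSq (fderiv ℝ (curl v) x)) →
        (sInf {κ : ℝ | ∀ (v : EuclideanSpace ℝ (Fin 3) → EuclideanSpace ℝ (Fin 3)) (M B : ℝ), ContDiff ℝ (⊤ : ℕ∞) v →
      Literature.Analysis.FluidPDE.VectorCalculus.IsDivFree v → (∀ x, ‖v x‖ ≤ M) → (∀ x, ‖fderiv ℝ v x‖ ≤ B) →
      (∫⁻ x, ‖iteratedFDeriv ℝ 0 v x‖ₑ ^ 2 < ⊤) → (∫⁻ x, ‖iteratedFDeriv ℝ 1 v x‖ₑ ^ 2 < ⊤) →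
      (∫⁻ x, ‖iteratedFDeriv ℝ 2 v x‖ₑ ^ 2 < ⊤) →
      |∫ x, ⟪Literature.Analysis.FluidPDE.curl v x, fderiv ℝ v x (Literature.Analysis.FluidPDE.curl v x)⟫_ℝ| ≤
        κ * M * Real.sqrt (∫ x, ‖Literature.Analysis.FluidPDE.curl v x‖ ^ 2) *
          Real.sqrt (∫ x, Literature.Analysis.FluidPDE.frobeniusNormSq (fderiv ℝ (Literature.Analysis.FluidPDE.curl v) x))} - ε)
            * M * Real.sqrt (∫ x, ‖curl v x‖ ^ 2) * Real.sqrt (∫ x, frobeniusNormSq (fderiv ℝ (curl v) x)) ≤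
          |∫ x, ⟪curl v x, fderiv ℝ v x (curl v x)⟫_ℝ| →
        ∫ x in {x | ‖curl v x‖ ^ 2 * (∫ y, ‖curl v y‖ ^ 2) ≤ η ^ 2 * M ^ 2 * ∫ y, frobeniusNormSq (fderiv ℝ (curl v) y)},
            ‖curl v x‖ ^ 2 ≤ δ * ∫ x, ‖curl v x‖ ^ 2 := by
  sorry


/-- Minimal SPACE–TIME CAMPBELL LAW interface (rev 3; = the Campbell clauses of the skeleton's `IsPreWindowLaw`): a jointly measurable random
space–time field, smooth slices at negative times, non-zero vorticity at the reference point `(τ₀, 0)`, integrable weights, and the Campbell–Mecke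
identity for SPATIAL shifts of the whole space–time field, twisted by `|curl 𝒲(τ₀, ·)|²`. -/
def IsSpaceTimeCampbellLaw {Ω : Type*} [MeasurableSpace Ω] (P : Measure Ω)
    (𝒲 : Ω → ℝ → EuclideanSpace ℝ (Fin 3) → EuclideanSpace ℝ (Fin 3)) (τ₀ : ℝ) : Prop :=
  IsProbabilityMeasure P ∧ τ₀ < 0 ∧
  Measurable (fun q : Ω × ℝ × EuclideanSpace ℝ (Fin 3) => 𝒲 q.1 q.2.1 q.2.2) ∧
  (∀ᵐ w ∂P, (∀ t : ℝ, t < 0 → ContDiff ℝ (⊤ : ℕ∞) (𝒲 w t)) ∧ curl (𝒲 w τ₀) 0 ≠ 0) ∧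
  (∀ a : EuclideanSpace ℝ (Fin 3), Integrable (fun w => ‖curl (𝒲 w τ₀) (-a)‖ ^ 2 / ‖curl (𝒲 w τ₀) 0‖ ^ 2) P) ∧
  (∀ (a : EuclideanSpace ℝ (Fin 3)) (Φ : (ℝ → EuclideanSpace ℝ (Fin 3) → EuclideanSpace ℝ (Fin 3)) → ℝ),
      Measurable Φ → (∀ W, |Φ W| ≤ 1) →
      ∫ w, Φ (fun t y => 𝒲 w t (y + a)) ∂P = ∫ w, Φ (𝒲 w) * (‖curl (𝒲 w τ₀) (-a)‖ ^ 2 / ‖curl (𝒲 w τ₀) 0‖ ^ 2) ∂P)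

/-- The density re-twisting a space–time Campbell law from reference time `τ₀` to time `τ`: `|curl 𝒲(τ,0)|² / |curl 𝒲(τ₀,0)|²`. -/
def retwistTimeDensity {Ω : Type*}
    (𝒲 : Ω → ℝ → EuclideanSpace ℝ (Fin 3) → EuclideanSpace ℝ (Fin 3)) (τ₀ τ : ℝ) : Ω → ℝ≥0∞ :=
  fun w => ENNReal.ofReal (‖curl (𝒲 w τ) 0‖ ^ 2 / ‖curl (𝒲 w τ₀) 0‖ ^ 2)

/-- **S1a internal lemma «WINDOW FATOU» (critic V41 P2 `stub_windowFatou`; PROVED here, rev 3.1 — no sorry).**  Measurable subsets `Eₙ ⊆ (a, b)` of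
Lebesgue measure `≥ m` have `limsup Eₙ = ⋂ₙ ⋃_{i ≥ n} Eᵢ` of measure `≥ m` (reverse Fatou for indicators on a finite-measure space).  Used with
`Eₙ` = the near-efficient τ-set of the n-th window in the parabolic variables of its final time: the limit set of times at which a sub-subsequence
is near-efficient has positive measure, and usc then gives exact extremality there.  (The analytic content of «Fatou in τ» is the per-τ usc,
which is part of `stub_preLawExtraction` proper.)  Proof: continuity from above (`Antitone.measure_iInter`) for the tails `⋃_{i≥n} Eᵢ ⊆ (a,b)`. [folklore] -/
theorem windowFatou :
    ∀ (a b m : ℝ) (E : ℕ → Set ℝ), (∀ n, MeasurableSet (E n)) → (∀ n, E n ⊆ Set.Ioo a b) →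
      (∀ n, ENNReal.ofReal m ≤ volume (E n)) →
        ENNReal.ofReal m ≤ volume (⋂ n : ℕ, ⋃ i : ℕ, ⋃ (_ : n ≤ i), E i) := by
  intro a b m E hmeas hsub hm
  set F : ℕ → Set ℝ := fun n => ⋃ i : ℕ, ⋃ (_ : n ≤ i), E i with hF
  have hanti : Antitone F := by
    intro n n' hnn' x hx
    simp only [hF, Set.mem_iUnion] at hx ⊢
    obtain ⟨i, hi, hx⟩ := hx
    exact ⟨i, le_trans hnn' hi, hx⟩
  have hFmeas : ∀ n, NullMeasurableSet (F n) volume := by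
    intro n
    exact (MeasurableSet.iUnion fun i => MeasurableSet.iUnion fun _ => hmeas i).nullMeasurableSet
  have hFsub : ∀ n, F n ⊆ Set.Ioo a b := by
    intro n
    simp only [hF, Set.iUnion_subset_iff]
    intro i _; exact hsub i
  have hfin : ∃ n, volume (F n) ≠ ⊤ := by
    refine ⟨0, ?_⟩
    exact (lt_of_le_of_lt (measure_mono (hFsub 0)) (by simp [Real.volume_Ioo])).ne
  have hEq : volume (⋂ n, F n) = ⨅ n, volume (F n) := hanti.measure_iInter hFmeas hfin
  show ENNReal.ofReal m ≤ volume (⋂ n, F n)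
  rw [hEq]
  refine le_iInf fun n => ?_
  calc ENNReal.ofReal m ≤ volume (E n) := hm n
    _ ≤ volume (F n) := by
        apply measure_mono
        intro x hx
        simp only [hF, Set.mem_iUnion]
        exact ⟨n, le_rfl, hx⟩


/-- **S1a internal lemma «RE-TWIST TO TIME τ» (critic V41 P2 `stub_retwistAbsCont`; TRUE modulo the stated side conditions, size M/L).**  For a
space–time Campbell law twisted at `τ₀` whose τ-slices a.s. have Lebesgue-null vorticity zero sets (analytic slices ≢ 0), the vorticity at
`(τ, 0)` is a.s. non-zero — proof: average the Campbell identity with `Φ = 1{ω(τ,0) = 0}` over shifts `a` in a ball and use Tonelli: on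
`{ω(τ,0) = 0}` one gets `∫_B |ω(τ₀,−a)|² da = 0`, contradicting continuity and `ω(τ₀,0) ≠ 0` — hence the re-twisting density has positive total
mass, the re-twisted normalised measure `P_τ` is a space–time Campbell law twisted at `τ` (the Mecke computation: apply the τ₀-identity to
`Ψ(W) = Φ(W)|ω(τ,−a)|²/|ω(τ₀,−a)|²`, telescoping on the P-full set `{ω(τ₀,−a) ≠ 0}`), and `P_τ ∼ P` (mutually absolutely continuous).  The
integrability of the new weights is ASSUMED (hint), as in `stub_campbellLaw_deform`.  [sources: LastPenrose2017 Ch. 9 (Mecke equation); Kallenberg2021] -/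
theorem stub_retwistAbsCont :
    ∀ (Ω : Type) (_ : MeasurableSpace Ω) (P : Measure Ω)
      (𝒲 : Ω → ℝ → EuclideanSpace ℝ (Fin 3) → EuclideanSpace ℝ (Fin 3)) (τ₀ τ : ℝ),
      IsSpaceTimeCampbellLaw P 𝒲 τ₀ → τ < 0 →
      (∀ᵐ w ∂P, volume {x : EuclideanSpace ℝ (Fin 3) | curl (𝒲 w τ) x = 0} = 0) →
      Measurable (retwistTimeDensity 𝒲 τ₀ τ) →
      ∫⁻ w, retwistTimeDensity 𝒲 τ₀ τ w ∂P < ⊤ →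
      (∀ a : EuclideanSpace ℝ (Fin 3), Integrable (fun w => ‖curl (𝒲 w τ) (-a)‖ ^ 2 / ‖curl (𝒲 w τ) 0‖ ^ 2)
        ((∫⁻ w, retwistTimeDensity 𝒲 τ₀ τ w ∂P)⁻¹ • P.withDensity (retwistTimeDensity 𝒲 τ₀ τ))) →
        0 < ∫⁻ w, retwistTimeDensity 𝒲 τ₀ τ w ∂P ∧
        IsSpaceTimeCampbellLaw ((∫⁻ w, retwistTimeDensity 𝒲 τ₀ τ w ∂P)⁻¹ • P.withDensity (retwistTimeDensity 𝒲 τ₀ τ)) 𝒲 τ ∧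
        ((∫⁻ w, retwistTimeDensity 𝒲 τ₀ τ w ∂P)⁻¹ • P.withDensity (retwistTimeDensity 𝒲 τ₀ τ)) ≪ P ∧
        P ≪ ((∫⁻ w, retwistTimeDensity 𝒲 τ₀ τ w ∂P)⁻¹ • P.withDensity (retwistTimeDensity 𝒲 τ₀ τ)) := by
  sorry


/-! ### Rev 3.5 REMARK (critic V42, for provers): every functional fed to the typed Campbell identities below (`Measurable Φ` for the PRODUCT
σ-algebra on `E³ → E³` / `ℝ → E³ → E³`) must be the COUNTABLE-LIMIT version of the intended one — derivative at a point := limit of rational difference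
quotients, `∫ v·f` := limit of rational Riemann sums, sup := rational-grid sup (`gridSup` in the skeleton) — which agrees with the intended functional on
the a.s.-smooth realisations; the Mecke computations in `stub_retwistAbsCont` / `stub_campbellLaw_deform` (Φ = 1{curl W(τ,0) = 0}, weights
|curl W(τ,−a)|²) go through in that reading plus dominated convergence.  A general «measurable shift-invariant functional» is CONSTANT on the product
σ-algebra (V42 P7), so ergodicity is expressed through named functionals only. -/

/-! ### Rev 3.4: the S2′ proof route (J1/A1/C1, PathwiseEL, stub_pathwiseEL, densityExtension (proved), stub_homogeneityContradiction)
MOVED into the skeleton `Lines/campbell_extremiser.lean` rev 3.4, where `sliceContact` is recomposed from them (booked once). -/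

/-- **First lemma of S2c `stub_cutoffAveraging` (rev 3.7; size S/M; TRUE: Fubini + monotone class + truncation from the bounded-Φ Campbell clause):
the INTEGRATED CAMPBELL IDENTITY (Mecke/Neveu exchange form).**  For a Campbell law and a jointly measurable `u ≥ 0` on (field, shift):
`E ∫ u(θ_a V, a) da = E ∫ u(V, a)·|curl V(−a)|²/|curl V(0)|² da`.  With `u(η, a) = χ(a/R)·F(η)·|curl η(0)|²` this gives the EXACT expectations of the
Palm-normalised cut-off terms (`E[F(V)·Y_R(V)]`), used in step (2) of the cut-off averaging. [sources: LastPenrose2017 §9.1–9.3; Kallenberg2021 Ch. 30] -/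
theorem stub_campbellFubini :
    ∀ (Ω : Type) (_ : MeasurableSpace Ω) (P : Measure Ω)
      (V : Ω → EuclideanSpace ℝ (Fin 3) → EuclideanSpace ℝ (Fin 3)),
      IsCampbellLaw P V →
      ∀ u : (EuclideanSpace ℝ (Fin 3) → EuclideanSpace ℝ (Fin 3)) → EuclideanSpace ℝ (Fin 3) → ℝ,
        Measurable (Function.uncurry u) → (∀ η a, 0 ≤ u η a) →
          ∫⁻ w, ∫⁻ a, ENNReal.ofReal (u (fun y => V w (y + a)) a) ∂volume ∂P =
            ∫⁻ w, ∫⁻ a, ENNReal.ofReal (u (V w) a * (‖curl (V w) (-a)‖ ^ 2 / ‖curl (V w) 0‖ ^ 2)) ∂volume ∂P := by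
  sorry

/-- Sanity (proved): the identity deformation `F = 0` re-twists by density `1`; recorded so the stub is not vacuous in the trivial direction —
`deformField V 0 ε = V`. [folklore] -/
theorem deformField_zero {Ω : Type*} (V : Ω → EuclideanSpace ℝ (Fin 3) → EuclideanSpace ℝ (Fin 3)) (ε : ℝ) :
    deformField V (fun _ => 0) ε = V := by
  funext w x
  simp [deformField]

end Summit.NavierStokesRegularity.NavierStokesRegularity.Cruxes.NearExtremalTransience.CampbellExtremiser

end
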